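import Mathlib
import HarnessLib
import Literature.Combinatorics.SimpleGraph.FKPseudomoments

/-!
# The filled-matrix shell, Step B, part 1: combinatorial tools (crux `PaleySosRung`, line
`weil-patch-transfer`, stub `stub_filledShell` / sub-goal `shell_patternPart`)

* `sum_superset_reindex` — `Σ_L [T ⊆ L] f L = Σ_A [Disjoint A T] f (A ∪ T)`;
* `sum_group_card` — grouping a sum over subsets by cardinality;
* `sum_pairs_by_inter` — `Σ_{L,R} F(L,R) = Σ_T Σ_{A,B} [A,B,T pairwise disjoint] F(A ∪ T, B ∪ T)`;
* `pattern_summand_eq`, `pattern_count_identity`, `sum_shifted_le` — the summand identity,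
  the counting identity `Σ_{|T|=s} ‖u_T^{(a)}‖² = C(a+s,s) X_{a+s}` and the final index count.
-/

set_option linter.dupNamespace false -- `Summit.PneNP.PneNP.…`: summit = sub-problem (D-0017)

namespace Summit.PneNP.PneNP.Theorems.PaleySosRungWeilPatch

open Finset

/-- Reindexing supersets of `T` by their part outside `T`:
`Σ_L [T ⊆ L] f L = Σ_A [Disjoint A T] f (A ∪ T)`. -/
theorem sum_superset_reindex {V : Type*} [Fintype V] [DecidableEq V] (T : Finset V)
    (f : Finset V → ℝ) :
    ∑ L : Finset V, (if T ⊆ L then f L else 0) =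
      ∑ A : Finset V, (if Disjoint A T then f (A ∪ T) else 0) := by
  rw [← Finset.sum_filter, ← Finset.sum_filter]
  refine Finset.sum_nbij' (fun L => L \ T) (fun A => A ∪ T) ?_ ?_ ?_ ?_ ?_
  · intro L hL
    simp only [Finset.mem_filter, Finset.mem_univ, true_and] at hL ⊢
    exact Finset.sdiff_disjoint
  · intro A hA
    simp only [Finset.mem_filter, Finset.mem_univ, true_and] at hA ⊢
    exact Finset.subset_union_right
  · intro L hL
    simp only [Finset.mem_filter, Finset.mem_univ, true_and] at hL
    exact Finset.sdiff_union_of_subset hL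
  · intro A hA
    simp only [Finset.mem_filter, Finset.mem_univ, true_and] at hA
    ext v
    simp only [Finset.mem_sdiff, Finset.mem_union]
    constructor
    · rintro ⟨h | h, hn⟩
      · exact h
      · exact absurd h hn
    · intro h
      exact ⟨Or.inl h, fun hT => Finset.disjoint_left.1 hA h hT⟩
  · intro L hL
    simp only [Finset.mem_filter, Finset.mem_univ, true_and] at hL
    rw [Finset.sdiff_union_of_subset hL]

/-- Grouping a sum over subsets by cardinality (for a summand vanishing above size `n`). -/
theorem sum_group_card {V : Type*} [Fintype V] [DecidableEq V] (n : ℕ) (F : Finset V → ℝ)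
    (hF : ∀ A : Finset V, n < A.card → F A = 0) :
    ∑ A : Finset V, F A = ∑ a ∈ Finset.range (n + 1), ∑ A : Finset V, (if A.card = a then F A else 0) := by
  rw [Finset.sum_comm]
  refine Finset.sum_congr rfl fun A _ => ?_
  rw [Finset.sum_ite_eq]
  by_cases hA : A.card ≤ n
  · rw [if_pos (Finset.mem_range.2 (by omega))]
  · rw [if_neg (fun h => hA (by have := Finset.mem_range.1 h; omega)), hF A (by omega)]

/-- `(A ∪ T) ∩ (B ∪ T) = T ↔ Disjoint A B` when `A` is disjoint from `T`. -/
theorem union_inter_union_eq_iff {V : Type*} [DecidableEq V] {A B T : Finset V}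
    (hA : Disjoint A T) : (A ∪ T) ∩ (B ∪ T) = T ↔ Disjoint A B := by
  constructor
  · intro h
    rw [Finset.disjoint_left]
    intro v hvA hvB
    have hv : v ∈ (A ∪ T) ∩ (B ∪ T) := by simp [hvA, hvB]
    rw [h] at hv
    exact Finset.disjoint_left.1 hA hvA hv
  · intro h
    ext v
    simp only [Finset.mem_inter, Finset.mem_union]
    constructor
    · rintro ⟨h1 | h1, h2 | h2⟩
      · exact absurd h2 (Finset.disjoint_left.1 h h1)
      · exact h2
      · exact h1
      · exact h1
    · intro hv; exact ⟨Or.inr hv, Or.inr hv⟩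

/-- **Pairs of subsets by their intersection**:
`Σ_{L,R} F(L,R) = Σ_T Σ_{A,B} [A ⟂ T][B ⟂ T][A ⟂ B] F(A ∪ T, B ∪ T)`. -/
theorem sum_pairs_by_inter {V : Type*} [Fintype V] [DecidableEq V] (F : Finset V → Finset V → ℝ) :
    ∑ L : Finset V, ∑ R : Finset V, F L R =
      ∑ T : Finset V, ∑ A : Finset V, ∑ B : Finset V,
        (if Disjoint A T ∧ Disjoint B T ∧ Disjoint A B then F (A ∪ T) (B ∪ T) else 0) := by
  -- insert `Σ_T [T = L ∩ R] = 1` and bring `T` outside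
  have h1 : ∑ L : Finset V, ∑ R : Finset V, F L R =
      ∑ T : Finset V, ∑ L : Finset V, ∑ R : Finset V, (if T = L ∩ R then F L R else 0) := by
    calc ∑ L : Finset V, ∑ R : Finset V, F L R
        = ∑ L : Finset V, ∑ R : Finset V, ∑ T : Finset V, (if T = L ∩ R then F L R else 0) := by
          refine Finset.sum_congr rfl fun L _ => Finset.sum_congr rfl fun R _ => ?_
          rw [Finset.sum_ite_eq' Finset.univ (L ∩ R) (fun _ => F L R), if_pos (Finset.mem_univ _)]
      _ = ∑ L : Finset V, ∑ T : Finset V, ∑ R : Finset V, (if T = L ∩ R then F L R else 0) :=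
          Finset.sum_congr rfl fun L _ => Finset.sum_comm
      _ = _ := Finset.sum_comm
  rw [h1]
  refine Finset.sum_congr rfl fun T _ => ?_
  -- for fixed `T`, reindex `L = A ∪ T`, `R = B ∪ T`
  have h2 : ∀ L R : Finset V, (if T = L ∩ R then F L R else 0) =
      if T ⊆ L then (if T ⊆ R then (if T = L ∩ R then F L R else 0) else 0) else 0 := by
    intro L R
    by_cases h : T = L ∩ R
    · have hL : T ⊆ L := h ▸ Finset.inter_subset_left
      have hR : T ⊆ R := h ▸ Finset.inter_subset_right
      rw [if_pos hL, if_pos hR]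
    · rw [if_neg h]; split_ifs <;> rfl
  calc ∑ L : Finset V, ∑ R : Finset V, (if T = L ∩ R then F L R else 0)
      = ∑ L : Finset V, (if T ⊆ L then
          ∑ R : Finset V, (if T ⊆ R then (if T = L ∩ R then F L R else 0) else 0) else 0) := by
        refine Finset.sum_congr rfl fun L _ => ?_
        by_cases hL : T ⊆ L
        · rw [if_pos hL]
          refine Finset.sum_congr rfl fun R _ => ?_
          rw [h2 L R, if_pos hL]
          by_cases hR : T ⊆ R
          · rw [if_pos hR, if_pos hR]
          · rw [if_neg hR, if_neg hR]
        · rw [if_neg hL]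
          exact Finset.sum_eq_zero fun R _ => by rw [h2 L R, if_neg hL]
    _ = ∑ A : Finset V, (if Disjoint A T then
          ∑ R : Finset V, (if T ⊆ R then (if T = (A ∪ T) ∩ R then F (A ∪ T) R else 0) else 0)
          else 0) :=
        sum_superset_reindex T _
    _ = ∑ A : Finset V, (if Disjoint A T then
          ∑ B : Finset V, (if Disjoint B T then
            (if T = (A ∪ T) ∩ (B ∪ T) then F (A ∪ T) (B ∪ T) else 0) else 0) else 0) := by
        refine Finset.sum_congr rfl fun A _ => ?_
        split_ifs with hA
        · exact sum_superset_reindex T _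
        · rfl
    _ = _ := by
        refine Finset.sum_congr rfl fun A _ => ?_
        by_cases hA : Disjoint A T
        · rw [if_pos hA]
          refine Finset.sum_congr rfl fun B _ => ?_
          by_cases hB : Disjoint B T
          · rw [if_pos hB]
            by_cases hAB : Disjoint A B
            · rw [if_pos ((union_inter_union_eq_iff hA).2 hAB).symm, if_pos ⟨hA, hB, hAB⟩]
            · rw [if_neg (fun h => hAB ((union_inter_union_eq_iff hA).1 h.symm)), if_neg]
              exact fun h => hAB h.2.2
          · rw [if_neg hB, if_neg (fun h => hB h.2.1)]
        · rw [if_neg hA]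
          exact (Finset.sum_eq_zero fun B _ => if_neg fun h => hA h.1).symm

/-- Sums over the fixed-size subtype are indicator sums over all subsets. -/
theorem sum_cardSubtype_eq {m a : ℕ} (h : Finset (Fin m) → ℝ) :
    ∑ A : {S : Finset (Fin m) // S.card = a}, h A.1 =
      ∑ A : Finset (Fin m), (if A.card = a then h A else 0) := by
  rw [← Finset.sum_subtype (Finset.univ.filter fun S : Finset (Fin m) => S.card = a)
    (fun S => by simp) h, Finset.sum_filter]

/-- Counting `s`-subsets: `Σ_T [|T| = s][T ⊆ L] = C(|L|, s)`. -/
theorem sum_indicator_subsets_card {V : Type*} [Fintype V] [DecidableEq V] (L : Finset V) (s : ℕ) :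
    ∑ T : Finset V, (if T.card = s ∧ T ⊆ L then (1 : ℝ) else 0) = (L.card.choose s : ℝ) := by
  rw [← Finset.card_powersetCard, Finset.sum_boole]
  congr 2
  ext T
  simp only [Finset.mem_filter, Finset.mem_univ, true_and, Finset.mem_powersetCard]
  tauto

/-- The `(T, A, B)`-summand of the pattern part: for `A, B, T` pairwise disjoint the entry
`x_{A∪T} x_{B∪T} · lev|L ∪ R| (bipInd(L,R) − 2^{-|L∖R||R∖L|})` (`L = A ∪ T`, `R = B ∪ T`) equals
`u_T(A) u_T(B) · lev(|A|+|B|+|T|)/2^{|A||B|} · cross(A,B)`, and both sides vanish otherwise. -/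
theorem pattern_summand_eq {m : ℕ} (G : SimpleGraph (Fin m)) [DecidableRel G.Adj] (lev : ℕ → ℝ)
    (x : Finset (Fin m) → ℝ) (T A B : Finset (Fin m)) :
    (if Disjoint A T ∧ Disjoint B T ∧ Disjoint A B then
        x (A ∪ T) * x (B ∪ T) * (lev ((A ∪ T) ∪ (B ∪ T)).card *
          (Literature.Combinatorics.SimpleGraph.bipInd G (A ∪ T) (B ∪ T) -
            1 / 2 ^ (((A ∪ T) \ (B ∪ T)).card * ((B ∪ T) \ (A ∪ T)).card))) else 0) =
      (if Disjoint A T then x (A ∪ T) else 0) * (if Disjoint B T then x (B ∪ T) else 0) *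
        (lev (A.card + B.card + T.card) / 2 ^ (A.card * B.card) *
          (if Disjoint A B then
            (if ∀ v ∈ A, ∀ w ∈ B, G.Adj v w then (2 : ℝ) ^ (A.card * B.card) - 1 else -1) else 0)) := by
  by_cases hAT : Disjoint A T
  · by_cases hBT : Disjoint B T
    · by_cases hAB : Disjoint A B
      · rw [if_pos ⟨hAT, hBT, hAB⟩, if_pos hAT, if_pos hBT, if_pos hAB]
        have h1 : (A ∪ T) \ (B ∪ T) = A := by
          ext v
          simp only [Finset.mem_sdiff, Finset.mem_union, not_or]
          constructor
          · rintro ⟨h | h, -, hT⟩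
            · exact h
            · exact absurd h hT
          · intro h
            exact ⟨Or.inl h, fun hB => Finset.disjoint_left.1 hAB h hB,
              fun hT => Finset.disjoint_left.1 hAT h hT⟩
        have h2 : (B ∪ T) \ (A ∪ T) = B := by
          ext v
          simp only [Finset.mem_sdiff, Finset.mem_union, not_or]
          constructor
          · rintro ⟨h | h, -, hT⟩
            · exact h
            · exact absurd h hT
          · intro h
            exact ⟨Or.inl h, fun hA => Finset.disjoint_left.1 hAB hA h,
              fun hT => Finset.disjoint_left.1 hBT h hT⟩
        have h3 : ((A ∪ T) ∪ (B ∪ T)).card = A.card + B.card + T.card := by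
          have hABT : (A ∪ T) ∪ (B ∪ T) = (A ∪ B) ∪ T := by
            ext v; simp only [Finset.mem_union]; tauto
          rw [hABT, Finset.card_union_of_disjoint, Finset.card_union_of_disjoint hAB]
          exact Finset.disjoint_union_left.2 ⟨hAT, hBT⟩
        rw [Literature.Combinatorics.SimpleGraph.bipInd_apply, h1, h2, h3]
        by_cases hadj : ∀ v ∈ A, ∀ w ∈ B, G.Adj v w
        · rw [if_pos hadj, if_pos hadj]
          field_simp
        · rw [if_neg hadj, if_neg hadj]
          ring
      · rw [if_neg (fun h => hAB h.2.2), if_neg hAB]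
        ring
    · rw [if_neg (fun h => hBT h.2.1), if_neg hBT]
      ring
  · rw [if_neg (fun h => hAT h.1), if_neg hAT]
    ring

/-- The counting identity behind the Cauchy–Schwarz step:
`Σ_{|T| = s} Σ_{|A| = a} u_T(A)² = C(a+s, s) · Σ_{|L| = a+s} x_L²`. -/
theorem pattern_count_identity {m : ℕ} (x : Finset (Fin m) → ℝ) (a s : ℕ) :
    ∑ T : Finset (Fin m), (if T.card = s then ∑ A : Finset (Fin m),
        (if A.card = a then (if Disjoint A T then x (A ∪ T) else 0) else 0) ^ 2 else 0) =
      ((a + s).choose s : ℝ) * ∑ L : Finset (Fin m), (if L.card = a + s then x L ^ 2 else 0) := by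
  have h1 : ∀ T : Finset (Fin m), T.card = s →
      ∑ A : Finset (Fin m), (if A.card = a then (if Disjoint A T then x (A ∪ T) else 0) else 0) ^ 2 =
      ∑ L : Finset (Fin m), (if T ⊆ L ∧ L.card = a + s then x L ^ 2 else 0) := by
    intro T hT
    have h := sum_superset_reindex T (fun L => if L.card = a + s then x L ^ 2 else 0)
    have h' : ∑ L : Finset (Fin m), (if T ⊆ L ∧ L.card = a + s then x L ^ 2 else 0) =
        ∑ L : Finset (Fin m), (if T ⊆ L then (if L.card = a + s then x L ^ 2 else 0) else 0) := by
      refine Finset.sum_congr rfl fun L _ => ?_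
      split_ifs <;> tauto
    rw [h', h]
    refine Finset.sum_congr rfl fun A _ => ?_
    by_cases hd : Disjoint A T
    · rw [if_pos hd, if_pos hd, Finset.card_union_of_disjoint hd, hT]
      by_cases hA : A.card = a
      · rw [if_pos hA, if_pos (by omega)]
      · rw [if_neg hA, if_neg (by omega)]; ring
    · rw [if_neg hd, if_neg hd]; split_ifs <;> ring
  calc ∑ T : Finset (Fin m), (if T.card = s then ∑ A : Finset (Fin m),
        (if A.card = a then (if Disjoint A T then x (A ∪ T) else 0) else 0) ^ 2 else 0)
      = ∑ T : Finset (Fin m), ∑ L : Finset (Fin m),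
          (if T.card = s ∧ T ⊆ L then (if L.card = a + s then x L ^ 2 else 0) else 0) := by
        refine Finset.sum_congr rfl fun T _ => ?_
        by_cases hT : T.card = s
        · rw [if_pos hT, h1 T hT]
          refine Finset.sum_congr rfl fun L _ => ?_
          by_cases hTL : T ⊆ L
          · rw [if_pos (And.intro hT hTL)]
            by_cases hL : L.card = a + s
            · rw [if_pos (And.intro hTL hL), if_pos hL]
            · rw [if_neg (fun h => hL h.2), if_neg hL]
          · rw [if_neg (fun h => hTL h.1), if_neg (fun h => hTL h.2)]
        · rw [if_neg hT]
          exact (Finset.sum_eq_zero fun L _ => if_neg fun h => hT h.1).symm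
    _ = ∑ L : Finset (Fin m), (if L.card = a + s then x L ^ 2 else 0) *
          ∑ T : Finset (Fin m), (if T.card = s ∧ T ⊆ L then (1 : ℝ) else 0) := by
        rw [Finset.sum_comm]
        refine Finset.sum_congr rfl fun L _ => ?_
        rw [Finset.mul_sum]
        refine Finset.sum_congr rfl fun T _ => ?_
        split_ifs <;> ring
    _ = ((a + s).choose s : ℝ) * ∑ L : Finset (Fin m), (if L.card = a + s then x L ^ 2 else 0) := by
        rw [Finset.mul_sum]
        refine Finset.sum_congr rfl fun L _ => ?_
        rw [sum_indicator_subsets_card L s]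
        by_cases hL : L.card = a + s
        · rw [if_pos hL, hL]; ring
        · rw [if_neg hL]; ring

/-- Each index `i = a + s` is hit by at most `t` pairs `(s, a)` with `a ≥ 1`, `a + s ≤ t`:
`Σ_s Σ_a [1 ≤ a ∧ a + s ≤ t] h(a+s) ≤ t Σ_{i ≤ t} h(i)` for `h ≥ 0`. -/
theorem sum_shifted_le (t : ℕ) (h : ℕ → ℝ) (hh : ∀ i, 0 ≤ h i) :
    ∑ s ∈ Finset.range (t + 1), ∑ a ∈ Finset.range (t + 1),
        (if 1 ≤ a ∧ a + s ≤ t then h (a + s) else 0) ≤ (t : ℝ) * ∑ i ∈ Finset.range (t + 1), h i := by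
  have hinner : ∀ s ∈ Finset.range (t + 1), ∑ a ∈ Finset.range (t + 1),
      (if 1 ≤ a ∧ a + s ≤ t then h (a + s) else 0) ≤
      if s < t then ∑ i ∈ Finset.range (t + 1), h i else 0 := by
    intro s _
    split_ifs with hst
    · calc ∑ a ∈ Finset.range (t + 1), (if 1 ≤ a ∧ a + s ≤ t then h (a + s) else 0)
          = ∑ a ∈ (Finset.range (t + 1)).filter (fun a => 1 ≤ a ∧ a + s ≤ t), h (a + s) :=
            (Finset.sum_filter _ _).symm
        _ = ∑ i ∈ ((Finset.range (t + 1)).filter (fun a => 1 ≤ a ∧ a + s ≤ t)).image (· + s), h i := by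
            rw [Finset.sum_image]
            intro a _ b _ hab; simpa using hab
        _ ≤ ∑ i ∈ Finset.range (t + 1), h i := by
            refine Finset.sum_le_sum_of_subset_of_nonneg ?_ fun i _ _ => hh i
            intro i hi
            rw [Finset.mem_image] at hi
            obtain ⟨a, ha, rfl⟩ := hi
            rw [Finset.mem_filter] at ha
            rw [Finset.mem_range]; omega
    · refine (Finset.sum_eq_zero fun a _ => ?_).le
      rw [if_neg]; omega
  refine (Finset.sum_le_sum hinner).trans ?_
  rw [← Finset.sum_filter]
  have hfil : (Finset.range (t + 1)).filter (fun s => s < t) = Finset.range t := by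
    ext s; simp only [Finset.mem_filter, Finset.mem_range]; omega
  rw [hfil, Finset.sum_const, Finset.card_range, nsmul_eq_mul]

/-- Registered sub-goal `aux_patternTools` of stub `stub_filledShell` (crux stmt-PneNP-9817): the
reindexing of pairs of subsets by their intersection (`sum_pairs_by_inter` on `Fin m`). -/
theorem aux_patternTools : ∀ (m : ℕ) (F : Finset (Fin m) → Finset (Fin m) → ℝ),
    ∑ L : Finset (Fin m), ∑ R : Finset (Fin m), F L R =
      ∑ T : Finset (Fin m), ∑ A : Finset (Fin m), ∑ B : Finset (Fin m),
        (if Disjoint A T ∧ Disjoint B T ∧ Disjoint A B then F (A ∪ T) (B ∪ T) else 0) :=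
  fun _ F => sum_pairs_by_inter F

end Summit.PneNP.PneNP.Theorems.PaleySosRungWeilPatch
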